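import Literature.InformationTheory.QuantumCodes.GraphCodes
import Literature.InformationTheory.Entanglement.GraphStateLocalComplementation
import HarnessLib

/-!
# Graph codes under local complementation and graph isomorphism (Danielsen–Parker Thm. 11, Thm. 12 «if»)

Topic `Literature/InformationTheory/QuantumCodes` (LADDER-QEC, LIT-1 custody: the `[[n,0,d]]` column — self-dual
additive codes classified by graphs up to local complementation (LC) and isomorphism). Companion of
`GraphCodes.lean` (DP06 Def. 5, Thm. 6, Thm. 11 in matrix form, Thm. 15), written against the tree's graph-theoretic
local complementation `GraphStateLC.localComplement G a` / `GraphStateLC.lcSequence G L` of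
`Literature/InformationTheory/Entanglement/GraphStateLocalComplementation.lean` (Hein–Eisert–Briegel's `τ_a`; reused,
not re-defined) and Mathlib's `SimpleGraph.adjMatrix`, `SimpleGraph.Iso`.

**Source (read on the page).** L. E. Danielsen, M. G. Parker, *On the classification of all self-dual additive codes
over GF(4) of length up to 12*, J. Combin. Theory Ser. A 113 (2006) 1351–1367 = arXiv:math/0504522
[DanielsenParker2006], §4 (arXiv chunk p0008 L3–60): «Definition 8. Given a graph `G=(V,E)` and a vertex `v ∈ V`, let
`N_v ⊂ V` be the neighbourhood of `v`. Local complementation (LC) on `v` transforms `G` into `G^v`. To obtain `G^v`,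
we replace the induced subgraph of `G` on `N_v` by its complement.» «Theorem 11. Let `Γ` be the adjacency matrix of
the graph `G=(V,E)`, and `Γ^v` be the adjacency matrix of `G^v`, for any `v ∈ V`. The codes generated by
`C = Γ + ωI` and `C' = Γ^v + ωI` are equivalent.» «Theorem 12. Two self-dual additive codes over GF(4), `𝒞` and
`𝒞'`, with graph representations `G` and `G'`, are equivalent if and only if there is a finite sequence of not
necessarily distinct vertices `(v_1, v_2, …, v_i)`, such that `(((G^{v_1})^{v_2})^{⋯})^{v_i}` is isomorphic to `G'`.
Sketch of proof. … The codes obtained by the `n!` possible permutations of coordinates correspond to graph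
isomorphisms. …»

* §1 `adjMatrix_localComplement_apply` — the adjacency matrix of `τ_v(G)`: `Γ^v_{ij} = Γ_{ij} + Γ_{vi}Γ_{vj}`
  (`i ≠ j`), zero diagonal; `DanielsenParker2006_theorem11_graph` — Thm. 11 for a Mathlib `SimpleGraph (Fin n)` and
  the tree's `localComplement` (from the matrix form `DanielsenParker2006_theorem11` of `GraphCodes.lean`).
* §2 `permQubits_smul_graphCode` — a coordinate permutation `σ` carries `graphCode Γ` to the graph code of the
  relabelled matrix `Γ ∘ (σ⁻¹ × σ⁻¹)`; `exists_smul_graphCode_eq_of_iso` — isomorphic graphs have equivalent graph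
  codes («the `n!` possible permutations of coordinates correspond to graph isomorphisms»).
* §3 `DanielsenParker2006_theorem12_if` — the «if» direction of Thm. 12: a sequence of local complementations
  followed by a graph isomorphism yields an equivalent code. The «only if» direction (every equivalence of graph
  codes factors this way; Van den Nest–Dehaene–De Moor / Bouchet / Glynn, DP06's «Sketch of proof») is NOT
  formalised here and is not asserted.

No named facts; no instances; no new definitions.
-/

namespace Literature.InformationTheory.QuantumCodes

open Finset Module
open Literature.InformationTheory.Entanglement

open scoped Pointwise

variable {n : ℕ}

/-! ### §1. The adjacency matrix of `τ_v(G)` and Theorem 11 for graphs -/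

/-- **The adjacency matrix of the local complement**: for `i ≠ j`, `Γ^v_{ij} = Γ_{ij} + Γ_{vi}Γ_{vj}` over `𝔽₂`
(the edges inside `N_v` are complemented, all others kept), and `Γ^v_{ii} = 0`.
[cite: DanielsenParker2006, §4 Def. 8 (arXiv:math/0504522 chunk p0008 L3–8); HeinEtAl2006GraphStates, §2.2 («`τ_a(G) := G + N_a`»)] -/
theorem adjMatrix_localComplement_apply (G : SimpleGraph (Fin n)) [DecidableRel G.Adj] (v i j : Fin n) :
    (GraphStateLC.localComplement G v).adjMatrix (ZMod 2) i j =
      if i = j then 0 else G.adjMatrix (ZMod 2) i j + G.adjMatrix (ZMod 2) v i * G.adjMatrix (ZMod 2) v j := by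
  by_cases hij : i = j
  · subst hij
    simp [SimpleGraph.adjMatrix_apply]
  · have hiff := GraphStateLC.localComplement_adj G (a := v) (u := i) (v := j)
    simp only [SimpleGraph.adjMatrix_apply, if_neg hij, hiff]
    have h11 : (1 : ZMod 2) + 1 = 0 := by decide
    by_cases h1 : G.Adj i j <;> by_cases h2 : G.Adj v i <;> by_cases h3 : G.Adj v j <;> simp [h1, h2, h3, hij, h11]

/-- **Danielsen–Parker 2006, Theorem 11 (graph form).** For a simple graph `G` on the `n` coordinates and a vertex
`v`, the graph codes of `G` and of its local complement `τ_v(G)` are `𝒢ₙ`-equivalent.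
[cite: DanielsenParker2006, §4 Thm. 11 (arXiv:math/0504522 chunk p0008 L28–42)] -/
theorem DanielsenParker2006_theorem11_graph (G : SimpleGraph (Fin n)) [DecidableRel G.Adj] (v : Fin n) :
    ∃ g : codeEquivGroup n,
      g • graphCode (G.adjMatrix (ZMod 2)) = graphCode ((GraphStateLC.localComplement G v).adjMatrix (ZMod 2)) :=
  DanielsenParker2006_theorem11 (G.isSymm_adjMatrix (α := ZMod 2)) (fun i => by simp [SimpleGraph.adjMatrix_apply]) v
    (adjMatrix_localComplement_apply G v)

/-! ### §2. Graph isomorphisms are coordinate permutations -/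

/-- A coordinate permutation `σ` (an element of `𝒢ₙ`) maps `graphCode Γ` onto the graph code of the relabelled matrix
`(i, j) ↦ Γ (σ⁻¹ i) (σ⁻¹ j)` («The codes obtained by the `n!` possible permutations of coordinates correspond to
graph isomorphisms»). [cite: DanielsenParker2006, §4 sketch of proof of Thm. 12 (chunk p0008 L55–57)] -/
theorem permQubits_smul_graphCode (σ : Equiv.Perm (Fin n)) (Γ : Matrix (Fin n) (Fin n) (ZMod 2)) :
    (⟨permQubits σ, permQubits_mem_codeEquivGroup σ⟩ : codeEquivGroup n) • graphCode Γ =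
      graphCode (fun i j => Γ (σ.symm i) (σ.symm j)) := by
  classical
  rw [smul_eq_map, graphCode, graphCode, Submodule.map_span, ← Set.range_comp]
  -- the image of generator `i` of `(Γ|I)` is generator `σ i` of the relabelled matrix
  have key : (⇑((permQubits σ : SympVec n ≃ₗ[ZMod 2] SympVec n) : SympVec n →ₗ[ZMod 2] SympVec n) ∘
      fun i : Fin n => ((fun j => Γ i j, Pi.single i 1) : SympVec n)) =
      (fun i : Fin n => ((fun j => Γ (σ.symm i) (σ.symm j), Pi.single i 1) : SympVec n)) ∘ σ := by
    funext i
    simp only [Function.comp_apply, LinearEquiv.coe_coe, permQubits_apply]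
    refine Prod.ext (funext fun j => by simp) (funext fun j => ?_)
    simp only [Pi.single_apply]
    by_cases h : j = σ i
    · subst h; simp
    · have h' : σ.symm j ≠ i := fun h'' => h (by rw [← h'', Equiv.apply_symm_apply])
      simp [h, h']
  rw [key, Set.range_comp, σ.surjective.range_eq, Set.image_univ]

/-- **Isomorphic graphs have equivalent graph codes** (by the coordinate permutation underlying the isomorphism).
[cite: DanielsenParker2006, §4 sketch of proof of Thm. 12 (chunk p0008 L55–57)] -/
theorem exists_smul_graphCode_eq_of_iso {G G' : SimpleGraph (Fin n)} [DecidableRel G.Adj] [DecidableRel G'.Adj]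
    (φ : G ≃g G') : ∃ g : codeEquivGroup n, g • graphCode (G.adjMatrix (ZMod 2)) = graphCode (G'.adjMatrix (ZMod 2)) := by
  refine ⟨⟨permQubits φ.toEquiv, permQubits_mem_codeEquivGroup _⟩, ?_⟩
  rw [permQubits_smul_graphCode]
  congr 1
  have h := SimpleGraph.Iso.reindex_adjMatrix (ZMod 2) φ
  rw [← h]
  rfl

/-! ### §3. Theorem 12, «if» direction -/

/-- Graph codes of graphs related by a sequence of local complementations are equivalent (Thm. 11 iterated).
[cite: DanielsenParker2006, §4 Thm. 11–12 (chunk p0008 L28–60)] -/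
theorem exists_smul_graphCode_eq_lcSequence (G : SimpleGraph (Fin n)) [DecidableRel G.Adj] :
    ∀ (L : List (Fin n)) [DecidableRel (GraphStateLC.lcSequence G L).Adj],
      ∃ g : codeEquivGroup n,
        g • graphCode (G.adjMatrix (ZMod 2)) = graphCode ((GraphStateLC.lcSequence G L).adjMatrix (ZMod 2))
  | [], inst => ⟨1, by
      rw [one_smul]
      congr 1
      ext i j
      simp only [SimpleGraph.adjMatrix_apply, GraphStateLC.lcSequence_nil]
      congr 1⟩
  | a :: L, inst => by
    haveI hL : DecidableRel (GraphStateLC.lcSequence G L).Adj := Classical.decRel _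
    obtain ⟨g₁, h₁⟩ := exists_smul_graphCode_eq_lcSequence G L
    obtain ⟨g₂, h₂⟩ := DanielsenParker2006_theorem11_graph (GraphStateLC.lcSequence G L) a
    refine ⟨g₂ * g₁, ?_⟩
    rw [mul_smul, h₁, h₂]
    congr 1
    ext i j
    simp only [SimpleGraph.adjMatrix_apply, GraphStateLC.lcSequence_cons]
    congr 1

/-- **Danielsen–Parker 2006, Theorem 12, «if» direction.** If `G'` is isomorphic to a graph obtained from `G` by a
finite sequence of local complementations, then the graph codes of `G` and `G'` are `𝒢ₙ`-equivalent («if there is a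
finite sequence of not necessarily distinct vertices `(v_1, …, v_i)` such that `(((G^{v_1})^{v_2})^{⋯})^{v_i}` is
isomorphic to `G'`» ⇒ «`𝒞` and `𝒞'` … are equivalent»). The converse («only if», DP06's sketch of proof after
Van den Nest–Dehaene–De Moor, Bouchet, Glynn) is not formalised here.
[cite: DanielsenParker2006, §4 Thm. 12 (arXiv:math/0504522 chunk p0008 L45–60)] -/
theorem DanielsenParker2006_theorem12_if {G G' : SimpleGraph (Fin n)} [DecidableRel G.Adj] [DecidableRel G'.Adj]
    (L : List (Fin n)) [DecidableRel (GraphStateLC.lcSequence G L).Adj] (φ : GraphStateLC.lcSequence G L ≃g G') :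
    ∃ g : codeEquivGroup n, g • graphCode (G.adjMatrix (ZMod 2)) = graphCode (G'.adjMatrix (ZMod 2)) := by
  obtain ⟨g₁, h₁⟩ := exists_smul_graphCode_eq_lcSequence G L
  obtain ⟨g₂, h₂⟩ := exists_smul_graphCode_eq_of_iso φ
  exact ⟨g₂ * g₁, by rw [mul_smul, h₁, h₂]⟩

end Literature.InformationTheory.QuantumCodes
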